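import Summits.AnomalousDissipation.AnomalousDissipation.Theorems.SolenoidalFractalHomogenisationLagrangianStepVmodFlatBlocksE
import Summits.AnomalousDissipation.AnomalousDissipation.Theorems.SolenoidalFractalHomogenisationLagrangianStepVmodCoarseSupp
import Summits.AnomalousDissipation.AnomalousDissipation.Theorems.SolenoidalFractalHomogenisationLagrangianStepVmodCoarseDecay
import Summits.AnomalousDissipation.AnomalousDissipation.Theorems.SolenoidalFractalHomogenisationLagrangianStepFlatBilinearWindow
import Summits.AnomalousDissipation.AnomalousDissipation.Theorems.SolenoidalFractalHomogenisationRealisedQuasiStaticCellLawSectorExists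
import HarnessLib

/-!
# K1L_D (stmt-AnomalousDissipation-27980): (V_mod) flat stage, block (ss) REDUCED TO SINGLE REAL MODE PAIRS
(line file of the (V_mod) lane; prover ad-sawtooth-k1loc-p1 g14; on top of `…VmodFlatBlocksE` (p706403), `…VmodCoarseSupp` (p706221),
`…VmodCoarseDecay` (p706789) and lead-k1l-onelevel-p1's slow×slow assembly `PropagatorSymm.abs_inner_sub_le_sqrt_of_modewise` (`…FlatBilinearAssembly`).)

The (ss) block of the flat clause asks, for slow-supported data `x, ζ` (no modes outside `freqBall (n/4)`),
`|⟪(U−T)(s,t)x, ζ⟫| ≤ η·√lossFwd(T s t)x·√lossAdj(T s t)ζ`.  The flat pair is CLASS-DIAGONAL: the cell propagator `U` preserves the class pairs of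
the grid `(n⁻¹ℤ)³` (`PropagatorSymm.fcoeff_apply_eq_zero_of_classes`, grid-periodic cell carrier `cell_add_grid`) and the coarse member `T` is a
Fourier multiplier (`VmodFlat.fc_propagator_eq_zero`), while two nonzero slow modes never share a class pair (`FlatWindow.alone_of_lt`,
`not_selfConj_of_lt`, `2·(n/4) < n`).  Hence (lead's assembly) the block follows from a MODEWISE bound on single real mode pairs, with weights
`d_ℓ = 1 − exp(−8π²·loT·|ℓ|²·(t−s))`, `loT = (1/n²)(ν + c/ν)(lo/Λ)` a uniform lower ellipticity constant of the coarse member, which are dominated by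
the coarse losses modewise (`…VmodCoarseDecay`):
* `SSMode_textE e` — THE SINGLE-PAIR TARGET: for every nonzero slow `ℓ` and every weakly divergence-free `v ∈ V2` supported on `{ℓ, −ℓ}`,
  `‖𝓕((U−T)(s,t)v)(ℓ)‖ ≤ η(t−s)·d_ℓ·‖𝓕v(ℓ)‖`, `η = C₁(C₁(ν^{eσ} + (⌈K/ν⌉/n)^{eσ}) + min(1,P/(t−s))^{eσ})`, `C₁ ≥ C`, from (V);
* `BssNZ_textE e` — the (ss) block on data supported on `freqBall (n/4) ∖ {0}`;
* **`bssNZ_of_ssMode : SSMode_textE e → BssNZ_textE e`** (PROVED).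
The constant mode `ℓ = 0` (solenoidal constants, fixed by both members) is left to the bridge `BssNZ → Bss` (next file).  `sorry`-free;
NOT a proof of (ss), of the stub, of K1L_D or AD; rung F-D1.A0.
-/

set_option linter.dupNamespace false

noncomputable section

namespace Summit.AnomalousDissipation.AnomalousDissipation.Theorems.SolenoidalFractalHomogenisation.LagrangianStep.VmodFlat

open Literature.Analysis Literature.Analysis.FluidPDE Literature.Analysis.FunctionSpaces
open MeasureTheory Set Filter UnitAddTorus
open scoped ENNReal NNReal InnerProductSpace
open Summit.AnomalousDissipation.AnomalousDissipation.Theorems.SolenoidalFractalHomogenisation.LagrangianStep.CellClauseMod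
open Summit.AnomalousDissipation.AnomalousDissipation.Theorems.SolenoidalFractalHomogenisation.RealisedQuasiStaticCellLaw
  (isSmooth_cell isDivFree_cell memLp_top_stLift_cell)

/-! ## §1 Texts -/

/-- Nonzero slow data: supported on `freqBall (n/4) ∖ {0}`. -/
def IsSlowNZ (n : ℕ) (x : V2) : Prop := ∀ k, k ∉ (Torus.freqBall (d := Fin 3) (n / 4)).erase 0 → fc x k = 0

/-- A uniform lower ellipticity constant of the coarse tensor `(1/n²)(𝔸 + (c/ν)Φν((1/ν)𝔸))` on the window (`λ, λ′ ≤ Λ`). -/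
def loT (lo Λ c ν : ℝ) (n : ℕ) : ℝ := (1 / (n:ℝ) ^ 2) * ((ν + c / ν) * (lo / Λ))

/-- The modewise loss weight `d_ℓ(τ) = 1 − exp(−8π²·loT·|ℓ|²·τ)`. -/
def dW (lo Λ c ν : ℝ) (n : ℕ) (τ : ℝ) (ℓ : Fin 3 → ℤ) : ℝ :=
  1 - Real.exp (-(8 * Real.pi ^ 2 * loT lo Λ c ν n * Torus.freqNormSq ℓ * τ))

/-- **(ss-mode) THE SINGLE-PAIR TARGET** at output exponent `e σ`. -/
def SSMode_textE (e : ℝ → ℝ) : Prop := ∀ k (W : LatticeShear.LatticeWord k) (M : ℝ) (hM : 0 < M) (c : ℝ), 0 < c →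
  ∀ (Φ : ℝ → Torus.Visc4 (Fin 3) → Torus.Visc4 (Fin 3)) (lo hi Λ β σ C ν₀ K : ℝ),
    0 < lo → lo ≤ 1 → 1 ≤ hi → 1 < Λ → 0 ≤ β → 0 < σ → 0 ≤ C → 0 < ν₀ → ν₀ ≤ 1 → 0 < K →
    SlowVectorClauseF W M hM c Φ lo hi Λ β σ C ν₀ K →
    ∃ C₁ : ℝ, C ≤ C₁ ∧
    ∀ ν, ∀ hν : ν ∈ Set.Ioo 0 ν₀, ∀ n : ℕ, (⌈K / ν⌉₊ : ℝ) ≤ n → ∀ 𝔸 : Torus.Visc4 (Fin 3),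
      Torus.OddSmall 𝔸 (ν * β) → (∃ lam ∈ Set.Icc (1:ℝ) Λ, Torus.NearIso 𝔸 (ν * (lo / lam)) (ν * (hi * lam))) →
      Torus.OddSmall (Φ ν ((1 / ν) • 𝔸)) β → (∃ lam ∈ Set.Icc (1:ℝ) Λ, Torus.NearIso (Φ ν ((1 / ν) • 𝔸)) (lo / lam) (hi * lam)) →
      ∀ Tw > (0:ℝ), ∀ U T : ℝ → ℝ → (V2 →L[ℝ] V2),
        Torus.IsPropagator Tw (cellField W M hM ν hν.1 n) ((1 / (n:ℝ) ^ 2) • 𝔸) U →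
        Torus.IsPropagator Tw (fun _ _ => 0) ((1 / (n:ℝ) ^ 2) • (𝔸 + (c / ν) • Φ ν ((1 / ν) • 𝔸))) T →
      ∀ s t : ℝ, 0 ≤ s → s < t → t ≤ Tw →
      ∀ ℓ ∈ (Torus.freqBall (d := Fin 3) (n / 4)).erase 0, ∀ v : V2, v ∈ Torus.divFreeL2 (Fin 3) →
        (∀ k', k' ≠ ℓ → k' ≠ -ℓ → fc v k' = 0) →
        ‖fc (U s t v - T s t v) ℓ‖
          ≤ (C₁ * (C₁ * (ν ^ e σ + ((⌈K / ν⌉₊ : ℝ) / n) ^ e σ) + (min 1 ((M * W.period / ν) / (t - s))) ^ e σ))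
            * dW lo Λ c ν n (t - s) ℓ * ‖fc v ℓ‖

/-- (ss) on NONZERO slow data, output exponent `e σ`. -/
def BssNZ_textE (e : ℝ → ℝ) : Prop := ∀ k (W : LatticeShear.LatticeWord k) (M : ℝ) (hM : 0 < M) (c : ℝ), 0 < c →
  ∀ (Φ : ℝ → Torus.Visc4 (Fin 3) → Torus.Visc4 (Fin 3)) (lo hi Λ β σ C ν₀ K : ℝ),
    0 < lo → lo ≤ 1 → 1 ≤ hi → 1 < Λ → 0 ≤ β → 0 < σ → 0 ≤ C → 0 < ν₀ → ν₀ ≤ 1 → 0 < K →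
    SlowVectorClauseF W M hM c Φ lo hi Λ β σ C ν₀ K →
    ∃ C₁ : ℝ, C ≤ C₁ ∧ BlockBound W M hM c Φ lo hi Λ β (e σ) C₁ ν₀ K IsSlowNZ IsSlowNZ

/-! ## §2 Weighted mode sums are dominated by the coarse losses -/

/-- For a carrier-free propagator with tensor `𝔹 ∈ NearIso lo′ hi′`, `lo′ > 0`, any finite frequency set `S`, any `x ∈ V2`:
`Σ_{k∈S} (1 − e^{−8π² lo′ |k|² (t−s)})‖𝓕x(k)‖² ≤ lossFwd (U s t) x`. [folklore] -/
theorem sum_weight_le_lossFwd {T₀ : ℝ} {𝔹 : Torus.Visc4 (Fin 3)} {lo' hi' : ℝ} (h𝔹 : Torus.NearIso 𝔹 lo' hi') (hlo' : 0 < lo')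
    {b : ℝ → VF} (hb : ∀ r y, b r y = 0) {U : ℝ → ℝ → (V2 →L[ℝ] V2)} (hU : Torus.IsPropagator T₀ b 𝔹 U)
    {s t : ℝ} (hs : 0 ≤ s) (hst : s ≤ t) (htT : t ≤ T₀) (S : Finset (Fin 3 → ℤ)) (x : V2) :
    ∑ k ∈ S, (1 - Real.exp (-(8 * Real.pi ^ 2 * lo' * Torus.freqNormSq k * (t - s)))) * ‖fc x k‖ ^ 2 ≤ lossFwd (U s t) x := by
  obtain rfl : b = fun (_ : ℝ) (_ : UnitAddTorus (Fin 3)) => (0 : EuclideanSpace ℝ (Fin 3)) := funext fun r => funext fun y => hb r y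
  set P := (Torus.divFreeL2 (Fin 3)).starProjection with hP
  set ek : (Fin 3 → ℤ) → ℝ := fun k => Real.exp (-(8 * Real.pi ^ 2 * lo' * Torus.freqNormSq k * (t - s))) with hek
  have hek1 : ∀ k, ek k ≤ 1 := fun k => by
    rw [hek]; apply Real.exp_le_one_iff.2
    have : 0 ≤ 8 * Real.pi ^ 2 * lo' * Torus.freqNormSq k * (t - s) := by
      have := Real.pi_pos; have := Torus.freqNormSq_nonneg k; have h2 : 0 ≤ t - s := by linarith
      positivity
    linarith
  have hPdiv : Torus.IsWeaklyDivFree (⇑(P x) : VF) := (Torus.mem_divFreeL2_iff _).1 ((Torus.divFreeL2 (Fin 3)).starProjection_apply_mem x)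
  -- modewise: `‖𝓕(U x)(k)‖² ≤ e_k ‖𝓕x(k)‖²`
  have hmode : ∀ k, ‖fc (U s t x) k‖ ^ 2 ≤ ek k * ‖fc x k‖ ^ 2 := by
    intro k
    rw [hU.apply_eq_apply_starProjection s t x]
    have hPk : ‖fc (P x) k‖ ≤ ‖fc x k‖ := Torus.norm_mFourierCoeff_starProjection_le x k
    rcases lt_or_eq_of_le (hst.trans htT) with hsT | hsT
    · have hdec := norm_sq_fcoeff_carrierFree_decay h𝔹 hlo' hU hs hst htT hsT (P x) hPdiv k
      exact hdec.trans (mul_le_mul_of_nonneg_left (pow_le_pow_left₀ (norm_nonneg _) hPk 2) (Real.exp_pos _).le)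
    · have hts : t = s := le_antisymm (hsT ▸ htT) hst
      have he : ek k = 1 := by rw [hek]; dsimp only; rw [hts, sub_self, mul_zero, neg_zero, Real.exp_zero]
      rw [hts, hU.self_of_divFree s hs (le_of_eq hsT) (P x) hPdiv, he, one_mul]
      exact pow_le_pow_left₀ (norm_nonneg _) hPk 2
  -- Parseval for `x` and `U x`
  have hx := hasSum_norm_sq_fcoeff x
  have hUx := hasSum_norm_sq_fcoeff (U s t x)
  have hdiff : HasSum (fun k => ‖fc x k‖ ^ 2 - ‖fc (U s t x) k‖ ^ 2) (lossFwd (U s t) x) := by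
    unfold lossFwd; exact hx.sub hUx
  have hnn : ∀ k, 0 ≤ ‖fc x k‖ ^ 2 - ‖fc (U s t x) k‖ ^ 2 := fun k => by
    have h1 := hmode k; have h2 := hek1 k; nlinarith [sq_nonneg ‖fc x k‖]
  have hS := sum_le_hasSum S (fun k _ => hnn k) hdiff
  refine le_trans (Finset.sum_le_sum fun k _ => ?_) hS
  have h1 := hmode k
  nlinarith [sq_nonneg ‖fc x k‖]

/-- The adjoint version: `Σ_{k∈S} (1 − e^{−8π² lo′ |k|² (t−s)})‖𝓕ζ(k)‖² ≤ lossAdj (U s t) ζ`. [folklore] -/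
theorem sum_weight_le_lossAdj {T₀ : ℝ} {𝔹 : Torus.Visc4 (Fin 3)} {lo' hi' : ℝ} (h𝔹 : Torus.NearIso 𝔹 lo' hi') (hlo' : 0 < lo')
    {U : ℝ → ℝ → (V2 →L[ℝ] V2)}
    (hU : Torus.IsPropagator T₀ (fun (_ : ℝ) (_ : UnitAddTorus (Fin 3)) => (0 : EuclideanSpace ℝ (Fin 3))) 𝔹 U)
    {s t : ℝ} (hs : 0 ≤ s) (hst : s ≤ t) (htT : t ≤ T₀) (S : Finset (Fin 3 → ℤ)) (ζ : V2) :
    ∑ k ∈ S, (1 - Real.exp (-(8 * Real.pi ^ 2 * lo' * Torus.freqNormSq k * (t - s)))) * ‖fc ζ k‖ ^ 2 ≤ lossAdj (U s t) ζ := by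
  rcases hst.eq_or_lt with hEq | hLt
  · subst hEq
    have h0 : ∀ k, (1 - Real.exp (-(8 * Real.pi ^ 2 * lo' * Torus.freqNormSq k * (s - s)))) * ‖fc ζ k‖ ^ 2 = 0 := fun k => by
      rw [sub_self, mul_zero, neg_zero, Real.exp_zero, sub_self, zero_mul]
    rw [Finset.sum_eq_zero fun k _ => h0 k]
    exact LossCurrency.lossAdj_nonneg (hU.norm_le s s) ζ
  · have hb : MemLp (Torus.stLift (fun (_ : ℝ) (_ : UnitAddTorus (Fin 3)) => (0 : EuclideanSpace ℝ (Fin 3)))) ∞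
        (volume.restrict (Ioo 0 T₀ ×ˢ (univ : Set (EuclideanSpace ℝ (Fin 3))))) := memLp_top_const 0
    have hbdiv : ∀ᵐ τ ∂(volume.restrict (Ioo (0:ℝ) T₀)),
        Torus.IsWeaklyDivFree ((fun (_ : ℝ) (_ : UnitAddTorus (Fin 3)) => (0 : EuclideanSpace ℝ (Fin 3))) τ) :=
      ae_of_all _ fun τ θ hθ => by simp
    unfold lossAdj
    rw [hU.adjoint_eq h𝔹 hlo' hb hbdiv hs hLt htT]
    have h𝔹' := (Torus.nearIso_majorTranspose_iff 𝔹 lo' hi').2 h𝔹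
    have hV := Torus.isPropagator_propagator h𝔹' hlo'
      (Torus.memLp_top_stLift_reversed_window hb hs htT) (Torus.ae_isWeaklyDivFree_reversed_window hbdiv hs htT)
    have h := sum_weight_le_lossFwd h𝔹' hlo' (fun r y => by simp) hV le_rfl (by linarith) le_rfl S ζ
    unfold lossFwd at h
    simpa only [sub_zero] using h

/-! ## §3 The reduction -/

set_option maxHeartbeats 1600000 in
/-- **(ss) on nonzero slow data from the single-pair modewise bound.** -/
theorem bssNZ_of_ssMode (e : ℝ → ℝ) (h : SSMode_textE e) : BssNZ_textE e := by
  intro k W M hM c hc Φ lo hi Λ β σ C ν₀ K hlo hlo1 hhi hΛ hβ hσ hC hν₀ hν₀1 hK hV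
  obtain ⟨C₁, hCC₁, hmode⟩ := h k W M hM c hc Φ lo hi Λ β σ C ν₀ K hlo hlo1 hhi hΛ hβ hσ hC hν₀ hν₀1 hK hV
  refine ⟨C₁, hCC₁, ?_⟩
  intro ν hν n hn 𝔸 hodd hwin hΦo hΦw Tw hTw U T hU hT s t hs hst htT x ζ hx hζ
  have hC₁ : 0 ≤ C₁ := hC.trans hCC₁
  -- the resolution `n ≥ 1` and the slow set
  have hn1 : (1:ℝ) ≤ n := by
    have h1 : (1:ℝ) ≤ ⌈K / ν⌉₊ := by
      have : 0 < K / ν := div_pos hK hν.1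
      exact_mod_cast Nat.one_le_iff_ne_zero.2 (Nat.pos_iff_ne_zero.1 (Nat.ceil_pos.2 this))
    exact h1.trans hn
  have hnpos : 0 < n := by exact_mod_cast (show (0:ℝ) < n by linarith)
  have hn0 : (0:ℝ) < n := by exact_mod_cast hnpos
  set S : Finset (Fin 3 → ℤ) := (Torus.freqBall (d := Fin 3) (n / 4)).erase 0 with hS
  have hLN : 2 * (n / 4) < n := by omega
  -- ellipticity windows of the two members
  obtain ⟨lam, hlam, hA𝔸⟩ := hwin
  obtain ⟨lam', hlam', hΦn⟩ := hΦw
  have hlam0 : 0 < lam := by linarith [hlam.1]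
  have hlam'0 : 0 < lam' := by linarith [hlam'.1]
  have hcν : 0 ≤ c / ν := div_nonneg hc.le hν.1.le
  have hn2 : (0:ℝ) < 1 / (n:ℝ) ^ 2 := by positivity
  have hcell : Torus.NearIso ((1 / (n:ℝ) ^ 2) • 𝔸) ((1 / (n:ℝ) ^ 2) * (ν * (lo / lam))) ((1 / (n:ℝ) ^ 2) * (ν * (hi * lam))) :=
    hA𝔸.smul hn2.le
  have hcell_lo : 0 < (1 / (n:ℝ) ^ 2) * (ν * (lo / lam)) := mul_pos hn2 (mul_pos hν.1 (div_pos hlo hlam0))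
  have hcoarse0 : Torus.NearIso ((1 / (n:ℝ) ^ 2) • (𝔸 + (c / ν) • Φ ν ((1 / ν) • 𝔸)))
      ((1 / (n:ℝ) ^ 2) * (ν * (lo / lam) + (c / ν) * (lo / lam'))) ((1 / (n:ℝ) ^ 2) * (ν * (hi * lam) + (c / ν) * (hi * lam'))) :=
    (hA𝔸.add (hΦn.smul hcν)).smul hn2.le
  -- weaken the lower constant to the uniform `loT`
  have hloT_le : loT lo Λ c ν n ≤ (1 / (n:ℝ) ^ 2) * (ν * (lo / lam) + (c / ν) * (lo / lam')) := by
    unfold loT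
    have h1 : lo / Λ ≤ lo / lam := div_le_div_of_nonneg_left hlo.le hlam0 hlam.2
    have h2 : lo / Λ ≤ lo / lam' := div_le_div_of_nonneg_left hlo.le hlam'0 hlam'.2
    have h3 : (ν + c / ν) * (lo / Λ) ≤ ν * (lo / lam) + (c / ν) * (lo / lam') := by
      have := mul_le_mul_of_nonneg_left h1 hν.1.le
      have := mul_le_mul_of_nonneg_left h2 hcν
      nlinarith
    exact mul_le_mul_of_nonneg_left h3 hn2.le
  have hΛ0 : 0 < Λ := by linarith
  have hloT : 0 < loT lo Λ c ν n := by
    unfold loT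
    have hνc : 0 < ν + c / ν := by have := hν.1; positivity
    exact mul_pos hn2 (mul_pos hνc (div_pos hlo hΛ0))
  have hcoarse : Torus.NearIso ((1 / (n:ℝ) ^ 2) • (𝔸 + (c / ν) • Φ ν ((1 / ν) • 𝔸)))
      (loT lo Λ c ν n) ((1 / (n:ℝ) ^ 2) * (ν * (hi * lam) + (c / ν) * (hi * lam'))) := hcoarse0.mono hloT_le le_rfl
  -- class preservation of the cell member (grid-periodic carrier) and of the coarse member (Fourier multiplier)
  have hbU : MemLp (Torus.stLift (cellField W M hM ν hν.1 n)) ∞ (volume.restrict (Ioo 0 Tw ×ˢ (univ : Set (EuclideanSpace ℝ (Fin 3))))) :=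
    memLp_top_stLift_cell _ n Tw
  have hbUdiv : ∀ᵐ τ ∂(volume.restrict (Ioo (0:ℝ) Tw)), Torus.IsWeaklyDivFree (cellField W M hM ν hν.1 n τ) :=
    ae_of_all _ fun τ => (isDivFree_cell _ n τ).isWeaklyDivFree_holds (isSmooth_cell _ n τ)
  have hgrid : ∀ (j : Fin 3 → Fin n) (τ : ℝ) (y : UnitAddTorus (Fin 3)),
      cellField W M hM ν hν.1 n τ (y + (fun i => ((((j i : ℕ) : ℝ) / n : ℝ) : UnitAddCircle))) = cellField W M hM ν hν.1 n τ y :=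
    fun j τ y => by unfold cellField; exact cell_add_grid _ hnpos j τ y
  have hUcl : ∀ (c' : Fin 3 → ℤ) (y : V2), (∀ k', ((∀ i, (n:ℤ) ∣ k' i - c' i) ∨ (∀ i, (n:ℤ) ∣ k' i + c' i)) →
        mFourierCoeff (EuclideanSpace.complexify ∘ ⇑y) k' = 0) →
      ∀ k', ((∀ i, (n:ℤ) ∣ k' i - c' i) ∨ (∀ i, (n:ℤ) ∣ k' i + c' i)) →
        mFourierCoeff (EuclideanSpace.complexify ∘ ⇑(U s t y)) k' = 0 :=
    fun c' y hy k' hk' => PropagatorSymm.fcoeff_apply_eq_zero_of_classes hU hcell hcell_lo hbU hbUdiv hnpos hgrid c' hs hst.le htT y hy k' hk'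
  have hTcl : ∀ (c' : Fin 3 → ℤ) (y : V2), (∀ k', ((∀ i, (n:ℤ) ∣ k' i - c' i) ∨ (∀ i, (n:ℤ) ∣ k' i + c' i)) →
        mFourierCoeff (EuclideanSpace.complexify ∘ ⇑y) k' = 0) →
      ∀ k', ((∀ i, (n:ℤ) ∣ k' i - c' i) ∨ (∀ i, (n:ℤ) ∣ k' i + c' i)) →
        mFourierCoeff (EuclideanSpace.complexify ∘ ⇑(T s t y)) k' = 0 :=
    fun c' y hy k' hk' => fc_propagator_eq_zero hcoarse hloT (fun _ _ => rfl) hT hs hst.le htT y (hy k' hk')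
  -- slow nonzero modes are alone in their class pairs and not self-conjugate
  have halone : ∀ ℓ ∈ S, ∀ k' ∈ S, ((∀ i, (n:ℤ) ∣ k' i - ℓ i) ∨ (∀ i, (n:ℤ) ∣ k' i + ℓ i)) → k' = ℓ ∨ k' = -ℓ :=
    fun ℓ hℓ k' hk' hpair => FlatWindow.alone_of_lt hLN (Finset.mem_of_mem_erase hℓ) (Finset.mem_of_mem_erase hk') hpair
  have hnsc : ∀ ℓ ∈ S, ¬ (∀ i, (n:ℤ) ∣ ℓ i + ℓ i) :=
    fun ℓ hℓ => FlatWindow.not_selfConj_of_lt hLN (Finset.mem_of_mem_erase hℓ) (Finset.ne_of_mem_erase hℓ)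
  -- the modewise bound with `ε_ℓ = η · d_ℓ`
  set η : ℝ := C₁ * (C₁ * (ν ^ e σ + ((⌈K / ν⌉₊ : ℝ) / n) ^ e σ) + (min 1 ((M * W.period / ν) / (t - s))) ^ e σ) with hη
  have hP0 : 0 ≤ (M * W.period / ν) / (t - s) :=
    div_nonneg (div_nonneg (mul_nonneg hM.le
      (Summit.AnomalousDissipation.AnomalousDissipation.Theorems.SolenoidalFractalHomogenisation.PermissibleCarrier.period_pos W).le) hν.1.le)
      (by linarith)
  have hη0 : 0 ≤ η := by
    have h1 : 0 ≤ ν ^ e σ := Real.rpow_nonneg hν.1.le _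
    have h2 : 0 ≤ ((⌈K / ν⌉₊ : ℝ) / n) ^ e σ := Real.rpow_nonneg (by positivity) _
    have h3 : 0 ≤ (min 1 ((M * W.period / ν) / (t - s))) ^ e σ := Real.rpow_nonneg (le_min zero_le_one hP0) _
    rw [hη]; exact mul_nonneg hC₁ (by positivity)
  set dd : (Fin 3 → ℤ) → ℝ := fun ℓ => dW lo Λ c ν n (t - s) ℓ with hdd
  have hdd0 : ∀ ℓ, 0 ≤ dd ℓ := fun ℓ => by
    rw [hdd]; unfold dW
    have : Real.exp (-(8 * Real.pi ^ 2 * loT lo Λ c ν n * Torus.freqNormSq ℓ * (t - s))) ≤ 1 := by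
      apply Real.exp_le_one_iff.2
      have := Real.pi_pos; have := Torus.freqNormSq_nonneg ℓ; have h2 : 0 ≤ t - s := by linarith
      have : 0 ≤ 8 * Real.pi ^ 2 * loT lo Λ c ν n * Torus.freqNormSq ℓ * (t - s) := by positivity
      linarith
    linarith
  have hmode' : ∀ ℓ ∈ S, ∀ v : V2, v ∈ Torus.divFreeL2 (Fin 3) →
      (∀ k', k' ≠ ℓ → k' ≠ -ℓ → mFourierCoeff (EuclideanSpace.complexify ∘ ⇑v) k' = 0) →
      ‖mFourierCoeff (EuclideanSpace.complexify ∘ ⇑(U s t v - T s t v)) ℓ‖ ≤ (η * dd ℓ) * ‖mFourierCoeff (EuclideanSpace.complexify ∘ ⇑v) ℓ‖ :=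
    fun ℓ hℓ v hv hvs => hmode ν hν n hn 𝔸 hodd ⟨lam, hlam, hA𝔸⟩ hΦo ⟨lam', hlam', hΦn⟩ Tw hTw U T hU hT s t hs hst htT ℓ hℓ v hv hvs
  have key := PropagatorSymm.abs_inner_sub_le_sqrt_of_modewise S (U s t) (T s t) (fun ℓ => η * dd ℓ) hnpos halone hnsc
    (fun ℓ => mul_nonneg hη0 (hdd0 ℓ)) (fun y => hU.apply_eq_apply_starProjection s t y) (fun y => hT.apply_eq_apply_starProjection s t y)
    hUcl hTcl hmode' dd η hη0 hdd0 (fun ℓ _ => le_rfl) x ζ hx hζ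
  -- the weighted sums are dominated by the coarse losses
  have hF : ∑ k' ∈ S, dd k' * ‖mFourierCoeff (EuclideanSpace.complexify ∘ ⇑x) k'‖ ^ 2 ≤ lossFwd (T s t) x :=
    sum_weight_le_lossFwd hcoarse hloT (fun _ _ => rfl) hT hs hst.le htT S x
  have hA : ∑ k' ∈ S, dd k' * ‖mFourierCoeff (EuclideanSpace.complexify ∘ ⇑ζ) k'‖ ^ 2 ≤ lossAdj (T s t) ζ :=
    sum_weight_le_lossAdj hcoarse hloT hT hs hst.le htT S ζ
  refine key.trans ?_
  have h1 := Real.sqrt_le_sqrt hF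
  have h2 := Real.sqrt_le_sqrt hA
  exact mul_le_mul (mul_le_mul_of_nonneg_left h1 hη0) h2 (Real.sqrt_nonneg _) (mul_nonneg hη0 (Real.sqrt_nonneg _))

end Summit.AnomalousDissipation.AnomalousDissipation.Theorems.SolenoidalFractalHomogenisation.LagrangianStep.VmodFlat

end
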